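import Summits.BirchSwinnertonDyer.BirchSwinnertonDyer.Theorems.UniversalToricDescentTowerDescent
import Summits.BirchSwinnertonDyer.BirchSwinnertonDyer.Theorems.UniversalToricDescentKummerPow
import Summits.BirchSwinnertonDyer.BirchSwinnertonDyer.Theorems.UniversalToricDescentLocalShapiroCount
import Summits.BirchSwinnertonDyer.BirchSwinnertonDyer.Theorems.UniversalToricDescentSigmaLocalStabilizer
import Summits.BirchSwinnertonDyer.BirchSwinnertonDyer.Theorems.SchneiderFreeControlAtoms
import Literature.NumberTheory.GaloisRepresentations.GaloisCohomologyLocalizationTransport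
import Summits.BirchSwinnertonDyer.Rank1Residual.Additive.AdicIntegersQuotientPrimePowCard
import Summits.BirchSwinnertonDyer.Rank1Residual.X11b.LocalTrivialityBridge
import HarnessLib

/-!
# Preliminaries for the local two-sided count at the strict place: `𝒪[K_v] = 𝓞_v` numerically, and the layers
# `κ₀⁻¹(p^{m} ℤ_p)` of a character of exact index (closed, open, index `p^n`)
# (crux ♭T≤ stmt-BirchSwinnertonDyer-23042, line `sigmacongruence`, stub TS1′ `stub_twinStrictSurj`, brick (1c±))

Route `UniversalToricDescent`, lead prover `bsd-wall-utd-p1` g17. THEOREMS ONLY (no definition, no named fact, no `sorry`);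
`--supports stmt-BirchSwinnertonDyer-23042`. BSD is not proved by any of this. See `…StrictPlaceLocalCount` for the assembly.

References: [Washington1997] §13.1; [MilneADT2006] I Thm. 2.8.
-/

set_option autoImplicit false
-- the Theorems namespace of this sub repeats the summit name by design (D-0017 nested layout)
set_option linter.dupNamespace false

noncomputable section

open scoped Classical ValuativeRel
open Function Field NumberField IsDedekindDomain
open Literature.NumberTheory.GaloisRepresentations Literature.NumberTheory.EllipticCurves
  Summit.BirchSwinnertonDyer.Rank1Residual.X11b Summit.BirchSwinnertonDyer.Rank1Residual.X11b.ProcyclicDescent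

universe u

namespace Summit.BirchSwinnertonDyer.BirchSwinnertonDyer.Theorems.UniversalToricDescentStrictPlaceLocalCount

/-! ### §0 The valuation ring of `K_v` is the ring of `v`-adic integers (numerically) -/

section Integers

variable (K : Type u) [Field K] [NumberField K] (v : HeightOneSpectrum (𝓞 K))

/-- `𝒪[K_v] = 𝓞_v` as subrings (`valuation K_v x ≤ 1 ↔ ‖x‖ ≤ 1`). [folklore] -/
theorem valuation_integer_eq_adicCompletionIntegers :
    (ValuativeRel.valuation (v.adicCompletion K)).integer = (v.adicCompletionIntegers K).toSubring := by
  ext x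
  rw [Valuation.mem_integer_iff, adicCompletion_valuation_le_one_iff K v x,
    ValuationSubring.mem_toSubring, HeightOneSpectrum.mem_adicCompletionIntegers,
    Valued.toNormedField.norm_le_one_iff]

/-- `#(𝒪[K_v] ⧸ m) = #(𝓞_v ⧸ m)` for `m : ℕ`. [folklore] -/
theorem natCard_integer_quotient_natCast_eq (m : ℕ) :
    Nat.card (𝒪[v.adicCompletion K] ⧸ Ideal.span {((m : ℕ) : 𝒪[v.adicCompletion K])}) =
      Nat.card (v.adicCompletionIntegers K ⧸ Ideal.span {((m : ℕ) : v.adicCompletionIntegers K)}) := by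
  have hO := valuation_integer_eq_adicCompletionIntegers K v
  let e : 𝒪[v.adicCompletion K] ≃+* v.adicCompletionIntegers K := RingEquiv.subringCongr hO
  have hIJ : Ideal.span {((m : ℕ) : v.adicCompletionIntegers K)} =
      (Ideal.span {((m : ℕ) : 𝒪[v.adicCompletion K])}).map (e : 𝒪[v.adicCompletion K] →+* _) := by
    rw [Ideal.map_span, Set.image_singleton, map_natCast]
  exact Nat.card_congr (Ideal.quotientEquiv _ _ e hIJ).toEquiv

end Integers

/-! ### §1 Layers of a character of exact index: closedness, openness, index `p^n` -/

section Layer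

variable {G : Type u} [Group G] [TopologicalSpace G]
variable {p : ℕ} [Fact p.Prime] (κ₀ : G →ₜ* Multiplicative ℤ_[p])
variable {c : ℕ} {δ₁ : G} (hδ₁ : (κ₀ δ₁).toAdd = (p : ℤ_[p]) ^ c) (hdvd : ∀ g : G, (p : ℤ_[p]) ^ c ∣ (κ₀ g).toAdd)
variable {Gn : Subgroup G} {n : ℕ} (hGn : ∀ g : G, g ∈ Gn ↔ (p : ℤ_[p]) ^ (c + n) ∣ (κ₀ g).toAdd)

include hGn in
/-- `G_n = κ₀⁻¹(p^{c+n} ℤ_p)` is the preimage of a closed ball, hence closed. [folklore] -/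
theorem isClosed_layer : IsClosed (Gn : Set G) := by
  have e : (Gn : Set G) = (fun g ↦ (κ₀ g).toAdd) ⁻¹' {x : ℤ_[p] | ‖x‖ ≤ (p : ℝ) ^ (-(c + n : ℕ) : ℤ)} := by
    ext g
    rw [SetLike.mem_coe, hGn, Set.mem_preimage, Set.mem_setOf_eq, PadicInt.norm_le_pow_iff_mem_span_pow,
      Ideal.mem_span_singleton]
  rw [e]
  exact (isClosed_le continuous_norm continuous_const).preimage (continuous_toAdd.comp κ₀.continuous)

include hGn in
/-- `G_n` is the preimage of the OPEN ball `p^{c+n} ℤ_p` (ultrametric), hence open. [folklore] -/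
theorem isOpen_layer : IsOpen (Gn : Set G) := by
  have e : (Gn : Set G) = (fun g ↦ (κ₀ g).toAdd) ⁻¹' Metric.closedBall (0 : ℤ_[p]) ((p : ℝ) ^ (-(c + n : ℕ) : ℤ)) := by
    ext g
    rw [SetLike.mem_coe, hGn, Set.mem_preimage, Metric.mem_closedBall, dist_zero_right,
      PadicInt.norm_le_pow_iff_mem_span_pow, Ideal.mem_span_singleton]
  rw [e]
  refine (IsUltrametricDist.isOpen_closedBall (0 : ℤ_[p]) ?_).preimage (continuous_toAdd.comp κ₀.continuous)
  exact (zpow_pos (by exact_mod_cast (Fact.out : p.Prime).pos) _).ne'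

include hδ₁ hdvd hGn in
/-- **`[G : G_n] = p^n`**: `g ↦ p^{-c} κ₀ g mod p^n` is onto `ℤ/p^n` (the rescaled character is onto `ℤ_p`) with kernel `G_n`.
[cite: Washington1997, §13.1] -/
theorem natCard_quotient_layer [CompactSpace G] [Gn.Normal] : Nat.card (G ⧸ Gn) = p ^ n := by
  let r := ProcyclicDescent.rescale κ₀ c hdvd
  have hr : ∀ g : G, (κ₀ g).toAdd = (p : ℤ_[p]) ^ c * (r g).toAdd := fun g ↦ by
    obtain ⟨z, hz⟩ := hdvd g
    rw [ProcyclicDescent.rescale_eq_of_eq κ₀ c hdvd g z hz, toAdd_ofAdd, hz]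
  let ψ : G →* Multiplicative (ZMod (p ^ n)) :=
    (AddMonoidHom.toMultiplicative ((PadicInt.toZModPow n : ℤ_[p] →+* ZMod (p ^ n)) : ℤ_[p] →+ ZMod (p ^ n))).comp
      (r : G →* Multiplicative ℤ_[p])
  have hψ : ∀ g : G, (ψ g).toAdd = PadicInt.toZModPow n (r g).toAdd := fun _ ↦ rfl
  have hsurj : Function.Surjective ψ := fun x ↦ by
    obtain ⟨g, hg⟩ := ProcyclicDescent.rescale_surjective κ₀ c hdvd δ₁ hδ₁ (Multiplicative.ofAdd ((x.toAdd.val : ℕ) : ℤ_[p]))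
    refine ⟨g, Multiplicative.toAdd.injective ?_⟩
    rw [hψ, hg, toAdd_ofAdd, map_natCast, ZMod.natCast_zmod_val]
  have hker : ψ.ker = Gn := by
    ext g
    rw [MonoidHom.mem_ker, hGn, hr g, pow_add]
    constructor
    · intro h
      have h' : PadicInt.toZModPow n (r g).toAdd = 0 := by rw [← hψ, h, toAdd_one]
      rw [← RingHom.mem_ker, PadicInt.ker_toZModPow, Ideal.mem_span_singleton] at h'
      exact mul_dvd_mul_left _ h'
    · intro h
      have hp0 : (p : ℤ_[p]) ^ c ≠ 0 := pow_ne_zero _ (by exact_mod_cast (Fact.out : p.Prime).ne_zero)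
      have h' : (p : ℤ_[p]) ^ n ∣ (r g).toAdd := (mul_dvd_mul_iff_left hp0).mp h
      apply Multiplicative.toAdd.injective
      rw [hψ, toAdd_one, ← RingHom.mem_ker, PadicInt.ker_toZModPow, Ideal.mem_span_singleton]
      exact h'
  rw [← hker, Nat.card_congr (QuotientGroup.quotientKerEquivOfSurjective ψ hsurj).toEquiv, Nat.card_eq_fintype_card,
    Fintype.card_multiplicative, ZMod.card]

omit hGn in
/-- The layer `κ₀⁻¹(p^m ℤ_p)` as a subgroup (the preimage of the subgroup `p^m ℤ_p` of `ℤ_p`), characterised by membership.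
[folklore] -/
theorem exists_layer (m : ℕ) : ∃ Gm : Subgroup G, ∀ g : G, g ∈ Gm ↔ (p : ℤ_[p]) ^ m ∣ (κ₀ g).toAdd :=
  ⟨((Ideal.span {(p : ℤ_[p]) ^ m}).toAddSubgroup.toSubgroup).comap (κ₀ : G →* Multiplicative ℤ_[p]), fun g ↦ by
    rw [Subgroup.mem_comap, Multiplicative.mem_toSubgroup, Submodule.mem_toAddSubgroup, Ideal.mem_span_singleton]
    rfl⟩

end Layer


end Summit.BirchSwinnertonDyer.BirchSwinnertonDyer.Theorems.UniversalToricDescentStrictPlaceLocalCount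

end
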